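import Summits.MatrixMultiplication.MatrixMultiplication.Theorems.NilpotentLieHostsUnitriangularCostShapeModelAction

/-!
# `UnitriangularCostShape` — Product model, part 4: splitting coefficients along disjoint variable sets

Crux `stmt-MatrixMultiplication-7724` (`NilpotentLieHosts.UnitriangularCostShape`), line `registered`
(`Cruxes/UnitriangularCostShape/Lines/birth.lean`), stub `stub_productModel` (the Weyl-type product model of
`U(u_d)/I^(s+1)` over the truncated Casimir algebra, `b = k = ⌊d/2⌋`).  Helper vocabulary and lemmas, namespace
`…Theorems.UnitriangularCostShape.ProductModel`.

`coeff_mul_of_disjoint`, the `v`-support family `VS`, and the coefficients of the exponential factor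
(`coeff_prod_expK`, `coeff_zero_prod_expK`).
-/

set_option linter.dupNamespace false

noncomputable section

namespace Summit.MatrixMultiplication.MatrixMultiplication.Theorems.UnitriangularCostShape.ProductModel

open MvPolynomial
open scoped BigOperators Pointwise

variable {d : ℕ}

/-- If the `v`-monomials of `P` only involve variables where `pv` holds and those of `Q` only
variables where it fails, coefficients of `P Q` split as a product. -/
theorem coeff_mul_of_disjoint (pv : Var d → Prop) [DecidablePred pv] {P Q : MvPolynomial (Var d) (A d)}
    (hP : ∀ x ∈ JSupp P, ∀ u ∈ x.2.support, pv u) (hQ : ∀ x ∈ JSupp Q, ∀ u ∈ x.2.support, ¬ pv u)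
    (γ : Var d →₀ ℕ) :
    coeff γ (P * Q) = coeff (γ.filter pv) P * coeff (γ.filter (fun u => ¬ pv u)) Q := by
  classical
  rw [coeff_mul, Finset.sum_eq_single (γ.filter pv, γ.filter (fun u => ¬ pv u))]
  · intro y hy hne
    by_contra h
    have h1 : coeff y.1 P ≠ 0 := left_ne_zero_of_mul h
    have h2 : coeff y.2 Q ≠ 0 := right_ne_zero_of_mul h
    obtain ⟨b1, hb1⟩ := MvPolynomial.support_nonempty.mpr h1
    obtain ⟨b2, hb2⟩ := MvPolynomial.support_nonempty.mpr h2
    have hy1 : ∀ u ∈ y.1.support, pv u := hP (b1, y.1) hb1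
    have hy2 : ∀ u ∈ y.2.support, ¬ pv u := hQ (b2, y.2) hb2
    rw [Finset.HasAntidiagonal.mem_antidiagonal] at hy
    apply hne
    have key : ∀ u, (if pv u then y.2 u = 0 else y.1 u = 0) := by
      intro u
      split_ifs with hu
      · by_contra h'; exact hy2 u (Finsupp.mem_support_iff.mpr h') hu
      · by_contra h'; exact hu (hy1 u (Finsupp.mem_support_iff.mpr h'))
    refine Prod.ext ?_ ?_
    · ext u
      rw [Finsupp.filter_apply]
      have hu := key u
      have hsum : y.1 u + y.2 u = γ u := by rw [← Finsupp.add_apply, hy]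
      split_ifs at hu ⊢ with h'
      · omega
      · exact hu
    · ext u
      rw [Finsupp.filter_apply]
      have hu := key u
      have hsum : y.1 u + y.2 u = γ u := by rw [← Finsupp.add_apply, hy]
      by_cases h' : pv u
      · rw [if_pos h'] at hu; rw [if_neg (not_not_intro h')]; exact hu
      · rw [if_neg h'] at hu; rw [if_pos h']; omega
  · intro h
    exfalso; apply h
    rw [Finset.HasAntidiagonal.mem_antidiagonal]
    exact Finsupp.filter_add_filter_not γ pv

/-- The family "all `v`-variables lie in `t`" (constant, additive). -/
def VS (t : Set (Var d)) : Set ((Fin d × Fin d →₀ ℕ) × (Var d →₀ ℕ)) :=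
  {x | ∀ u ∈ x.2.support, u ∈ t}

/-- The family `VS t` is additive. -/
theorem vs_add (t : Set (Var d)) : ∀ (a b : Unit) x y, x ∈ VS (d := d) t → y ∈ VS t →
    x + y ∈ (fun _ : Unit => VS t) (a + b) := by
  classical
  intro _ _ x y hx hy u hu
  simp only [Prod.snd_add] at hu
  rcases Finset.mem_union.mp (Finsupp.support_add hu) with h | h
  · exact hx u h
  · exact hy u h

/-- `0 ∈ VS t`. -/
theorem zero_mem_vs (t : Set (Var d)) : (0 : (Fin d × Fin d →₀ ℕ) × (Var d →₀ ℕ)) ∈ VS t := by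
  intro u hu; simp at hu

/-- Constants have no `v`-variables. -/
theorem jsupp_C_subset_vs (t : Set (Var d)) (a : A d) : JSupp (C a : MvPolynomial (Var d) (A d)) ⊆ VS t := by
  intro x hx
  have := jsupp_C a hx
  intro u hu; rw [this.1] at hu; simp at hu

/-- A variable in `t` has its `v`-variables in `t`. -/
theorem jsupp_X_subset_vs {t : Set (Var d)} {u : Var d} (hu : u ∈ t) :
    JSupp (X u : MvPolynomial (Var d) (A d)) ⊆ VS t := by
  classical
  intro x hx
  have := jsupp_X u hx
  rw [Set.mem_singleton_iff] at this
  intro u' hu'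
  rw [this] at hu'
  have h' : u' = u := by
    by_contra h'
    rw [Finsupp.mem_support_iff, Finsupp.single_apply, if_neg (Ne.symm h')] at hu'
    exact hu' rfl
  rw [h']; exact hu

/-- Products preserve `VS t`. -/
theorem jsupp_mul_subset_vs {t : Set (Var d)} {P Q : MvPolynomial (Var d) (A d)}
    (hP : JSupp P ⊆ VS t) (hQ : JSupp Q ⊆ VS t) : JSupp (P * Q) ⊆ VS t :=
  jsupp_mul_subset (fun _ : Unit => VS t) (vs_add t) (a := ()) (b := ()) hP hQ

/-- Powers preserve `VS t`. -/
theorem jsupp_pow_subset_vs {t : Set (Var d)} {P : MvPolynomial (Var d) (A d)}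
    (hP : JSupp P ⊆ VS t) (n : ℕ) : JSupp (P ^ n) ⊆ VS t := by
  have := jsupp_pow_subset (fun _ : ℕ => VS t) (fun _ _ x y hx hy => vs_add t () () x y hx hy)
    (zero_mem_vs t) (a := 0) hP n
  exact this

/-- Finite products preserve `VS t`. -/
theorem jsupp_prod_subset_vs {ι : Type*} (s : Finset ι) {t : Set (Var d)}
    {P : ι → MvPolynomial (Var d) (A d)} (hP : ∀ i ∈ s, JSupp (P i) ⊆ VS t) :
    JSupp (∏ i ∈ s, P i) ⊆ VS t := by
  have := jsupp_prod_subset s (fun _ : ℕ => VS t) (fun _ _ x y hx hy => vs_add t () () x y hx hy)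
    (zero_mem_vs t) (a := fun _ => 0) hP
  exact this

/-- Truncated exponentials preserve `VS t`. -/
theorem jsupp_expK_subset_vs {t : Set (Var d)} (K : ℕ) {y : MvPolynomial (Var d) (A d)}
    (hy : JSupp y ⊆ VS t) : JSupp (expK K y) ⊆ VS t := by
  unfold expK
  refine jsupp_sum_subset _ _ fun k _ => (jsupp_smul _ _).trans (jsupp_pow_subset_vs hy k)

/-- `σ(v_u)` only involves variables in the column of `u`. -/
theorem jsupp_sigmaX_subset_vs (c : Matrix (Fin d) (Fin d) (A d)) (u : Var d) :
    JSupp (sigmaX c u) ⊆ VS {u' | u'.col = u.col} := by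
  unfold sigmaX
  refine (jsupp_add _ _).trans (Set.union_subset (jsupp_X_subset_vs rfl) ?_)
  refine jsupp_sum_subset _ _ fun u' _ => ?_
  split_ifs with h
  · exact jsupp_mul_subset_vs (jsupp_C_subset_vs _ _) (jsupp_X_subset_vs h.1)
  · rw [jsupp_zero]; exact Set.empty_subset _

/-- `σ (v^α)` only involves variables in the columns of `α`. -/
theorem jsupp_sigma_monomial_subset_vs (c : Matrix (Fin d) (Fin d) (A d)) {t : Set (Var d)}
    (ht : ∀ u u' : Var d, u ∈ t → u'.col = u.col → u' ∈ t) (α : Var d →₀ ℕ)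
    (hα : ∀ u ∈ α.support, u ∈ t) :
    JSupp (sigma c (monomial α 1)) ⊆ VS t := by
  classical
  rw [MvPolynomial.monomial_eq, map_mul, sigma_C, Finsupp.prod, map_prod]
  refine jsupp_mul_subset_vs (jsupp_C_subset_vs _ _) (jsupp_prod_subset_vs _ fun u hu => ?_)
  rw [map_pow, sigma_X]
  refine jsupp_pow_subset_vs ((jsupp_sigmaX_subset_vs c u).trans fun x hx u' hu' => ?_) _
  exact ht u u' (hα u hu) (hx u' hu')

/-- The exponential factor attached to a set `s` of variables only involves those variables. -/
theorem jsupp_prod_expK_subset_vs (K : ℕ) (s : Finset (Var d)) :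
    JSupp (∏ u ∈ s, expK K (C (Xmat d u.row u.col) * X u)) ⊆ VS (↑s : Set (Var d)) := by
  refine jsupp_prod_subset_vs _ fun u hu => jsupp_expK_subset_vs K ?_
  exact jsupp_mul_subset_vs (jsupp_C_subset_vs _ _) (jsupp_X_subset_vs (Finset.mem_coe.mpr hu))

/-- Coefficient of `v_u^k` in `expK K (a • v_u)`. -/
theorem coeff_single_expK (K : ℕ) (a : A d) (u : Var d) {k : ℕ} (hk : k < K) :
    coeff (Finsupp.single u k) (expK K (C a * X u) : MvPolynomial (Var d) (A d)) =
      algebraMap ℚ (A d) (k.factorial : ℚ)⁻¹ * a ^ k := by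
  classical
  unfold expK
  rw [coeff_sum, Finset.sum_eq_single k]
  · rw [coeff_smul, mul_pow, ← map_pow, coeff_C_mul, X_pow_eq_monomial, coeff_monomial, if_pos rfl,
      mul_one, Algebra.smul_def]
  · intro k' _ hk'
    rw [coeff_smul, mul_pow, ← map_pow, coeff_C_mul, X_pow_eq_monomial, coeff_monomial, if_neg, mul_zero,
      smul_zero]
    intro h
    exact hk' (by simpa using (Finsupp.single_injective u h))
  · intro h; exact absurd (Finset.mem_range.mpr hk) h

/-- Coefficients of the exponential factor: for `δ` supported in `s` with entries `< K`,
`coeff_δ (∏_{u∈s} expK K (x_u v_u)) = ∏_{u∈s} x_u^{δ_u} / δ_u!`. -/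
theorem coeff_prod_expK (K : ℕ) (s : Finset (Var d)) (δ : Var d →₀ ℕ) (hδ : ∀ u ∈ δ.support, u ∈ s)
    (hK : ∀ u, δ u < K) :
    coeff δ (∏ u ∈ s, expK K (C (Xmat d u.row u.col) * X u)) =
      ∏ u ∈ s, (algebraMap ℚ (A d) ((δ u).factorial : ℚ)⁻¹ * (Xmat d u.row u.col) ^ (δ u)) := by
  classical
  induction s using Finset.induction_on generalizing δ with
  | empty =>
    have : δ = 0 := by
      ext u
      by_contra h
      exact absurd (hδ u (Finsupp.mem_support_iff.mpr h)) (Finset.notMem_empty u)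
    subst this
    simp
  | insert u s hu ih =>
    rw [Finset.prod_insert hu, Finset.prod_insert hu,
      coeff_mul_of_disjoint (fun u' => u' = u)]
    · congr 1
      · have : δ.filter (fun u' => u' = u) = Finsupp.single u (δ u) := by
          ext u'
          rw [Finsupp.filter_apply, Finsupp.single_apply]
          by_cases h : u' = u
          · subst h; simp
          · rw [if_neg h, if_neg (Ne.symm h)]
        rw [this, coeff_single_expK K _ u (hK u)]
      · rw [ih (δ.filter fun u' => ¬ u' = u)]
        · refine Finset.prod_congr rfl fun u' hu' => ?_
          have : u' ≠ u := fun h => hu (h ▸ hu')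
          rw [Finsupp.filter_apply, if_pos this]
        · intro u' hu'
          rw [Finsupp.support_filter, Finset.mem_filter] at hu'
          have := hδ u' hu'.1
          rcases Finset.mem_insert.mp this with h | h
          · exact absurd h hu'.2
          · exact h
        · intro u'; rw [Finsupp.filter_apply]; split_ifs <;> [exact lt_of_le_of_lt (Nat.zero_le _) (hK u'); exact hK u']
    · intro x hx u' hu'
      have := jsupp_expK_subset_vs K
        (jsupp_mul_subset_vs (jsupp_C_subset_vs {u} _) (jsupp_X_subset_vs (Set.mem_singleton u))) hx
      exact this u' hu'
    · intro x hx u' hu' h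
      have := jsupp_prod_expK_subset_vs K s hx u' hu'
      rw [h] at this
      exact hu (Finset.mem_coe.mp this)

/-- Constant term of the exponential factor. -/
theorem coeff_zero_prod_expK {K : ℕ} (hK : 1 ≤ K) (s : Finset (Var d)) :
    coeff 0 (∏ u ∈ s, expK K (C (Xmat d u.row u.col) * X u)) = 1 := by
  rw [coeff_prod_expK K s 0 (by simp) (fun _ => hK)]
  simp

/-- Landing hook of part 4: constant term of the exponential factor. -/
theorem stub_pm_coeffExp : ∀ (d K : ℕ), 1 ≤ K → ∀ s : Finset (Var d), MvPolynomial.coeff 0 (∏ u ∈ s, expK K (MvPolynomial.C (Xmat d u.row u.col) * MvPolynomial.X u)) = 1 :=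
  fun _ _ hK s => coeff_zero_prod_expK hK s

end Summit.MatrixMultiplication.MatrixMultiplication.Theorems.UnitriangularCostShape.ProductModel
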